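import Literature.NumberTheory.LFunctions.KMVMomentsToHalfEdge
import Literature.NumberTheory.LFunctions.KMVMomentAsymptoticsUniqueness
import HarnessLib

/-!
# The first mollified moment beyond the diagonal has no off-diagonal main term below length `2`
# (prime level, weight `2`, `Q = 1`): Bettin's twisted first moment ⇒ `T₁(Δ', P, 1) = 0` on `(1, 2)`

Topic `Literature/NumberTheory/LFunctions` (cell landau-siegel, family B-fam; route
`PrimeLevelFamEdge`, crux K_B `BeyondDiagonalBeatsQuarter`, stub S1 `stub_firstCorrectionVanishes`
in its corrected form `Δ' < min Δ 2`, ls-ref-1 STUBNOTE-birth v0.3).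

THE QUESTION. `KMV2000.MomentAsymptotics 1 Δ T₁ T₂` (file `KMVMomentAsymptoticsBeyondDiagonal`) is
the printed SHAPE of the Kowalski–Michel–VanderKam mollified-moment asymptotics at prime level `q`,
weight `2`, on the window of logarithmic mollifier lengths `Δ' ∈ (1, Δ]` (mollifier `M = q̂^{Δ'}`,
`q̂ = √q/2π`), with would-be off-diagonal main-term functionals `T₁, T₂`. KMV print the first
moment (Prop. 4.1) only for `Δ' < 1` [KowalskiMichelVanderKam2000, §4 (16): the balanced
approximate functional equation; "the terms involving the sign of the functional equation `ε_f`
only contribute part of the remainder term", which needs `M < q̂`]. For the FIRST moment the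
natural range is `M < q`, i.e. `Δ' < 2`, and there the off-diagonal main term is ZERO. The printed
theorem that says so at an INDIVIDUAL prime level is Bettin's twisted first moment:

> **[Bettin2017, Thm. 1.1]** (S. Bettin, *The first moment of twisted Hecke `L`-functions with
> unbounded shifts*, Funct. Approx. Comment. Math. 57 (2017) = arXiv:1605.02440, p. 3; held
> `paper:arxiv-1605.02440` p0003–p0005). Let `N = p^ν` with `p` prime and `ν ≥ 1` and let `χ` be a
> primitive character modulo `q` with `(q,N) = 1`. Let `|Re(α)| ≪ 1/log N` and write
> `T = 1 + |Im(α)|`. Then, if `ν ≥ 2` and `p ∣ m` then `𝓜_m(α,χ;N) = 0`. In all other cases for all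
> `ε > 0` we have `𝓜_m(α,χ;N) = χ(m) m^{−1/2−α}(1 − δ_ν(p)) + O_ε((qTm)^{1/2} N^{−1+ε})` as `N` goes
> to infinity, where `δ_ν(p) = 0` if `ν = 1` …; here (§2, first display)
> `M_m(α,χ;N) := Σ^h_{f ∈ H_k(N)} a_f(m) L(½+α, f ⊗ χ)`, `k = 2` ("We take `k = 2` for simplicity"),
> `Σ^h` the harmonic average for which Petersson's formula reads `Σ^h_f a_f(m)a_f(n) = δ_{m,n} +
> 2πi^{−k} Σ_{N∣c} c^{−1}S(m,n;c)J₁(4π√(mn)/c)` (Lemma 2.2), `a_f(n)` the coefficients with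
> `f = Σ a_n(f) n^{(k−1)/2} e(nz)`, `L(s,f) = Σ a_n(f) n^{−s}` (centre `½`), and "If `N` is prime and
> `k = 2`, then `H_2(N) = H_2^*(N)` and so we obtain Theorem 1.1 in the case `ν = 1`."

WHAT IS TYPED / PROVED (D-0014: the fact is a `def … : Prop`; everything else is a theorem).
* §1 `bettin2017_theorem11_primeLevel` — NAMED FACT: the case `ν = 1` (prime level `N`), `k = 2`,
  trivial twist (`q = 1`, `χ = 1`), no shift (`α = 0`, `T = 1`) of the theorem above, in the tree's
  vocabulary: `Σ^h = GL2Family.harmonicSum N 2` (harmonic weights `ω_f = 1/(4π⟨f,f⟩)` over the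
  Hecke-normalised newforms `newforms0 N 2`, the normalisation in which Petersson's formula has
  diagonal `δ_{m,n}` — Iwaniec–Kowalski (14.59)–(14.60), exactly Bettin's Lemma 2.2),
  `a_f(m) = GL2Family.heckeLambda f m`, `L(½,f) = IwaniecSarnak.centralValue f` (the entire
  continuation of record of `Σ a_f(n)n^{−s}` at the classical centre, the object inside
  `KMV2000.completedL`, see `KMV2000.completedL_half`). Quantifier form of "`O_ε(…)` as `N → ∞`":
  `∀ ε > 0 ∃ C N₀ ∀ prime N ≥ N₀ ∀ m ≥ 1`. `-- TODO(general form): prime powers ν ≥ 2 (factor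
  1 − δ_ν(p)), primitive twists χ mod q, shifts |Re α| ≪ 1/log N with the factor (qT)^{1/2}.`
* §2 definitions with bodies: `KMV2000.mollifierCoeff P M m = μ(m)ψ(m)⁻¹m^{−1/2}P(log(M/m)/log M)`
  (the coefficient `x_m` of KMV's mollifier (9)), `KMV2000.mollifierMainSum P M =
  Σ_{m ≤ M} μ(m)ψ(m)⁻¹ m⁻¹ P(log(M/m)/log M)` (the diagonal sum of the first moment at `Q = 1`,
  KMV (16) at `k = 0` with `V ≡ 1`), and the PREDICATE `KMV2000.MollifierMainTermAsymp P`: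
  `mollifierMainSum P M = ζ(2)P′(1)/log M + O_P((log M)⁻²)` (KMV §4.1 (19)–(20) at `k = 0`: total
  residue `ζ(2)q̂^{1/2}P′(1)/log M`; a statement about `M` alone, the prime number theorem for
  `μ` in logarithmic means; NOT asserted here — it enters §4–§6 as a displayed hypothesis and is
  the subject of Part 2).
* §3 PROVED bookkeeping: `L^h(P,1) = q̂^{1/2} Σ_{m ≤ M} x_m · Σ^h_f λ_f(m)L(½,f)`
  (`KMV2000.LhPQ_one_eq_twisted`; finite sums, `finite_newforms0_holds`).
* §4 PROVED `KMV2000.firstDisplay_of_bettin`: Bettin's fact + `MollifierMainTermAsymp P` give, for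
  every `0 < Δ' < 2`, the FIRST display of `MomentAsymptotics` at `(P, Q = 1, Δ')` with ZERO extra
  main term: `‖L^h(P,1) − ζ(2)·√q̂/(Δ' log q̂)·(linForm Δ' P 1 + 0)‖ ≤ C√q̂ (log q̂)⁻²` for all large
  primes (error budget: `√q̂·Σ_{m ≤ M}|x_m|·C_ε m^{1/2}q^{−1+ε} ≤ √q̂·‖P‖_∞·q^{Δ'/2−1+ε}` with
  `ε = (2−Δ')/4`, and `q^{−(2−Δ')/4} ≤ (8/(2−Δ'))²(log q̂)⁻²`).
* §5 PROVED `KMV2000.T₁_apply_one_eq_zero`: if `MomentAsymptotics 1 Δ T₁ T₂` holds (`Δ > 1`), then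
  for every admissible `P` with `MollifierMainTermAsymp P` and every `1 < Δ' < min Δ 2`,
  `T₁ Δ' P 1 = 0` — restrict the hypothesis to `(1, Δ']`, compare with the pair
  `(T₁′, T₂)`, `T₁′ := 0` at `(P, 1)` and `T₁` elsewhere (its first display at `(P,1)` is §4, all
  other displays are the hypothesis' own), and apply the tree's uniqueness
  `KMV2000.T₁_eq_of_momentAsymptotics_of_le_two` (good primes are unbounded on `(0, 2]`).
* §6 PROVED `KMV2000.firstCorrectionVanishes_of_bettin`: the route stub S1 in its corrected form
  (`Δ' < min Δ 2`, profile `X²`, `Q = 1`) from the two displayed hypotheses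
  `bettin2017_theorem11_primeLevel` and `MollifierMainTermAsymp (X^2)`.

WHAT THIS IS NOT. No statement about derivatives (`Q ≠ 1`: Bettin's theorem has no `Λ^{(j)}`), so
the K_A stub `stub_firstMomentBeyond` (all even-or-odd `Q`) is NOT covered beyond `Δ' ≥ 1`; no
statement at the endpoint `Δ' = 2` (never used by K_B); no claim about the second moment, about
`BeyondDiagonalBeatsQuarter`, or about Landau–Siegel zeros. «The programme SEARCHES and TYPES; no
claim about Landau–Siegel zeros, Theorems 1–2 of arXiv:2211.02515 or a repaired Margin232 until a
kernel theorem says so.»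

## References

* [Bettin2017] S. Bettin, *The first moment of twisted Hecke L-functions with unbounded shifts*,
  Funct. Approx. Comment. Math. 57 (2017), doi:10.7169/facm/1624, arXiv:1605.02440 — Thm. 1.1
  (p. 3), §2 first display and Lemma 2.2 (pp. 4–5). [held: paper:arxiv-1605.02440 p0003–p0005]
* [KowalskiMichelVanderKam2000] E. Kowalski, P. Michel, J. VanderKam, J. reine angew. Math. 526
  (2000) 1–34 — §2 (8)–(9), §4 (14), (16), (19)–(20), Prop. 4.1, §6 p. 19.
  [held: paper:doi-10-1515-crll-2000-074 p0007, p0009–p0012, p0019]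
* [BalkanovaFrolenkov2017] O. Balkanova, D. Frolenkov, Monatsh. Math. 185 (2018), Thm. 1.6 (the
  same statement for prime powers `ν ≥ 2`, "particular case of theorem 1.1 of [Bet]"; tree:
  `NonvanishingPrimePowerLevel`). [held: paper:arxiv-1605.02434 p0004]
-/

noncomputable section

open scoped Real
open Finset Complex Polynomial CongruenceSubgroup
open Literature.NumberTheory.EllipticCurves.ModularForms

namespace Literature.NumberTheory.LFunctions

/-! ## §1. The printed input (Bettin 2017, Theorem 1.1: prime level, weight 2, no twist, no shift) -/

/-- **Bettin 2017, Theorem 1.1** (case `ν = 1`, `k = 2`, `χ` trivial, `α = 0`). Printed: "Let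
`N = p^ν` with `p` prime and `ν ≥ 1` and let `χ` be a primitive character modulo `q` with
`(q,N) = 1`. Let `|Re(α)| ≪ 1/log N` and write `T = 1+|Im(α)|`. Then … for all `ε > 0` we have
`𝓜_m(α,χ;N) = χ(m) m^{−1/2−α}(1 − δ_ν(p)) + O_ε((qTm)^{1/2} N^{−1+ε})`, as `N` goes to infinity,
where `δ_ν(p) = 0` if `ν = 1`", with `M_m(α,χ;N) = Σ^h_{f ∈ H_k(N)} a_f(m) L(½+α, f⊗χ)` (§2) and
"If `N` is prime and `k = 2`, then `H_2(N) = H_2^*(N)`". At `ν = 1`, `q = 1`, `α = 0`: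
`Σ^h_{f ∈ S_2(N)^*} λ_f(m) L(½,f) = m^{−1/2} + O_ε(m^{1/2} N^{−1+ε})` for prime `N → ∞`, uniformly in
`m ≥ 1`; `Σ^h` = the Petersson-normalised harmonic average `GL2Family.harmonicSum N 2` (Bettin's
Lemma 2.2 = Iwaniec–Kowalski (14.59)), `λ_f = GL2Family.heckeLambda`, `L(½,f) =
IwaniecSarnak.centralValue`.
-- TODO(general form): prime powers `ν ≥ 2` (factor `1 − δ_ν(p)`), primitive twists `χ mod q`,
-- shifts `α` (`|Re α| ≪ 1/log N`, factor `(qT)^{1/2}`).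
[cite: Bettin2017, Thm. 1.1 (p. 3) with §2 (first display) and Lemma 2.2] -/
def bettin2017_theorem11_primeLevel : Prop :=
  ∀ ε : ℝ, 0 < ε → ∃ C : ℝ, ∃ N₀ : ℕ, ∀ (N : ℕ) [NeZero N], N.Prime → N₀ ≤ N → ∀ m : ℕ, 1 ≤ m →
    ‖GL2Family.harmonicSum N 2
          (fun f ↦ GL2Family.heckeLambda f m * IwaniecSarnak.centralValue f) -
        (((m : ℝ) ^ (-(1 / 2 : ℝ)) : ℝ) : ℂ)‖ ≤
      C * (m : ℝ) ^ (1 / 2 : ℝ) * (N : ℝ) ^ (-1 + ε)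

namespace KMV2000

/-! ## §2. The mollifier coefficients, the diagonal sum at `Q = 1`, and its asymptotic (predicate) -/

/-- The coefficient `x_m = μ(m) ψ(m)⁻¹ m^{−1/2} P(log(M/m)/log M)` of KMV's mollifier (9),
`M_P(f) = Σ_{m ≤ M} λ_f(m) x_m`. [cite: KowalskiMichelVanderKam2000, (8)–(9)] -/
def mollifierCoeff (P : ℝ[X]) (M : ℝ) (m : ℕ) : ℝ :=
  (ArithmeticFunction.moebius m : ℝ) *
    ((psi m)⁻¹ * (m : ℝ) ^ (-(1 / 2 : ℝ)) * P.eval (Real.log (M / m) / Real.log M))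

/-- The DIAGONAL SUM of the first mollified moment at `Q = 1`:
`S_P(M) := Σ_{1 ≤ m ≤ M} μ(m) ψ(m)⁻¹ m⁻¹ P(log(M/m)/log M)` (KMV (16) at `k = 0` with `V ≡ 1`:
`L^h(P,1) = q̂^{1/2} S_P(M) +` off-diagonal). [cite: KowalskiMichelVanderKam2000, §4 (16)] -/
def mollifierMainSum (P : ℝ[X]) (M : ℝ) : ℝ :=
  ∑ m ∈ Icc 1 ⌊M⌋₊, (ArithmeticFunction.moebius m : ℝ) *
    ((psi m)⁻¹ * (m : ℝ)⁻¹ * P.eval (Real.log (M / m) / Real.log M))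

/-- The MAIN-TERM EVALUATION of the diagonal sum, as a predicate on the profile `P`:
`S_P(M) = ζ(2) P′(1)/log M + O_P((log M)⁻²)` (`ζ(2) = π²/6`; KMV §4.1: the total residue (20) at
`k = 0` is `ζ(2) q̂^{1/2} P′(1)/log M`, §4.2: the shifted contours contribute less by a power of
`log`). A statement about `M` alone (the prime number theorem for `μ` in logarithmic Riesz means);
NOT asserted in this file — displayed hypothesis of §4–§6.
[cite: KowalskiMichelVanderKam2000, §4.1 (19)–(20) and §4.2 (case k = 0)] -/
def MollifierMainTermAsymp (P : ℝ[X]) : Prop :=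
  ∃ C M₀ : ℝ, ∀ M : ℝ, M₀ ≤ M →
    |mollifierMainSum P M - π ^ 2 / 6 * (derivative P).eval 1 / Real.log M| ≤ C / Real.log M ^ 2

/-! ## §3. `L^h(P, 1)` through the twisted first moments `Σ^h λ_f(m) L(½, f)` -/

variable {q : ℕ} [NeZero q]

omit [NeZero q] in
/-- `M_P(f) = Σ_{m ≤ M} λ_f(m) · x_m`. [cite: KowalskiMichelVanderKam2000, (9)] -/
theorem mollifierP_eq_sum_mollifierCoeff (P : ℝ[X]) (M : ℝ) (f : CuspForm (Gamma0 q) 2) :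
    mollifierP q P M f =
      ∑ m ∈ Icc 1 ⌊M⌋₊, GL2Family.heckeLambda f m * (mollifierCoeff P M m : ℂ) := by
  unfold mollifierP mollifierCoeff
  refine Finset.sum_congr rfl fun m _ ↦ ?_
  push_cast
  ring

/-- **`L^h(P,1) = q̂^{1/2} Σ_{m ≤ M} x_m · Σ^h_f λ_f(m) L(½,f)`** (`Q̃Λ(½) = Λ(f,½) = q̂^{1/2}L(½,f)` at
`Q = 1`, the mollifier opened, the two finite sums exchanged).
[cite: KowalskiMichelVanderKam2000, §4 (14) and (16) (case k = 0)] -/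
theorem LhPQ_one_eq_twisted (P : ℝ[X]) (M : ℝ) :
    LhPQ q P 1 M = ((qhat q : ℝ) : ℂ) ^ (1 / 2 : ℂ) *
      ∑ m ∈ Icc 1 ⌊M⌋₊, (mollifierCoeff P M m : ℂ) *
        GL2Family.harmonicSum q 2
          (fun f ↦ GL2Family.heckeLambda f m * IwaniecSarnak.centralValue f) := by
  have hfin := finite_newforms0_holds q 2
  unfold LhPQ GL2Family.harmonicSum
  rw [finsum_mem_eq_finite_toFinset_sum _ hfin]
  have hinner : ∀ m : ℕ,
      (∑ᶠ f ∈ newforms0 q 2, (GL2Family.harmonicWeight f : ℂ) *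
          (GL2Family.heckeLambda f m * IwaniecSarnak.centralValue f)) =
        ∑ f ∈ hfin.toFinset, (GL2Family.harmonicWeight f : ℂ) *
          (GL2Family.heckeLambda f m * IwaniecSarnak.centralValue f) :=
    fun m ↦ finsum_mem_eq_finite_toFinset_sum _ hfin
  simp_rw [hinner]
  rw [Finset.mul_sum]
  simp_rw [Finset.mul_sum]
  rw [Finset.sum_comm]
  refine Finset.sum_congr rfl fun f _ ↦ ?_
  rw [Qtilde_one, completedL_half, mollifierP_eq_sum_mollifierCoeff, Finset.mul_sum, Finset.mul_sum]
  refine Finset.sum_congr rfl fun m _ ↦ ?_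
  ring

/-- The diagonal sum through the coefficients: `Σ_{m ≤ M} x_m · m^{−1/2} = S_P(M)`.
[cite: KowalskiMichelVanderKam2000, §4 (16) (case k = 0)] -/
theorem sum_mollifierCoeff_mul_rpow (P : ℝ[X]) (M : ℝ) :
    ∑ m ∈ Icc 1 ⌊M⌋₊, mollifierCoeff P M m * (m : ℝ) ^ (-(1 / 2 : ℝ)) = mollifierMainSum P M := by
  unfold mollifierCoeff mollifierMainSum
  refine Finset.sum_congr rfl fun m hm ↦ ?_
  have hm0 : (0 : ℝ) < m := by exact_mod_cast (Finset.mem_Icc.1 hm).1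
  have hpow : (m : ℝ) ^ (-(1 / 2 : ℝ)) * (m : ℝ) ^ (-(1 / 2 : ℝ)) = (m : ℝ)⁻¹ := by
    rw [← Real.rpow_add hm0]
    norm_num
    exact Real.rpow_neg_one (m : ℝ)
  calc (ArithmeticFunction.moebius m : ℝ) *
        ((psi m)⁻¹ * (m : ℝ) ^ (-(1 / 2 : ℝ)) * P.eval (Real.log (M / m) / Real.log M)) *
          (m : ℝ) ^ (-(1 / 2 : ℝ))
      = (ArithmeticFunction.moebius m : ℝ) * ((psi m)⁻¹ *
          ((m : ℝ) ^ (-(1 / 2 : ℝ)) * (m : ℝ) ^ (-(1 / 2 : ℝ))) *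
            P.eval (Real.log (M / m) / Real.log M)) := by ring
    _ = _ := by rw [hpow]

/-! ## §4. The first display with ZERO extra main term at `Q = 1`, `0 < Δ' < 2` -/

omit [NeZero q] in
/-- A bound for `|P|` on `[0, 1]` (compactness). [folklore] -/
private theorem exists_abs_eval_le_on_unitInterval (P : ℝ[X]) :
    ∃ B : ℝ, 0 ≤ B ∧ ∀ t ∈ Set.Icc (0 : ℝ) 1, |P.eval t| ≤ B := by
  obtain ⟨B₀, hB₀⟩ := isCompact_Icc.exists_bound_of_continuousOn
    (P.continuous.continuousOn : ContinuousOn (fun t : ℝ ↦ P.eval t) (Set.Icc (0 : ℝ) 1))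
  refine ⟨max B₀ 0, le_max_right _ _, fun t ht ↦ ?_⟩
  have h := hB₀ t ht
  rw [Real.norm_eq_abs] at h
  exact le_trans h (le_max_left _ _)

omit [NeZero q] in
/-- At `Q = 1` the linear form (30) is `P′(1)`. [cite: KowalskiMichelVanderKam2000, §6 (30)] -/
theorem linForm_one_right (Δ : ℝ) (P : ℝ[X]) : linForm Δ P 1 = (derivative P).eval 1 := by
  simp [linForm]

omit [NeZero q] in
/-- `q^{−a} ≤ (2/a)² (log q)⁻²` for `q > 1`, `a > 0` (`log q ≤ q^{a/2}/(a/2)`). [folklore] -/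
private theorem rpow_neg_le_div_log_sq {y a : ℝ} (hy : 1 < y) (ha : 0 < a) :
    y ^ (-a) ≤ (2 / a) ^ 2 * (Real.log y)⁻¹ ^ 2 := by
  have hy0 : 0 < y := by linarith
  have hlog0 : 0 < Real.log y := Real.log_pos hy
  have hlog : Real.log y ≤ y ^ (a / 2) / (a / 2) := Real.log_le_rpow_div hy0.le (by positivity)
  have h3 : Real.log y ^ 2 ≤ (y ^ (a / 2) / (a / 2)) ^ 2 := pow_le_pow_left₀ hlog0.le hlog 2
  have h4 : (y ^ (a / 2) / (a / 2)) ^ 2 = (2 / a) ^ 2 * y ^ a := by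
    rw [div_pow, ← Real.rpow_natCast (y ^ (a / 2)) 2, ← Real.rpow_mul hy0.le]
    push_cast
    rw [show a / 2 * 2 = a by ring]
    field_simp
  rw [h4] at h3
  have hya : 0 < y ^ a := Real.rpow_pos_of_pos hy0 a
  rw [Real.rpow_neg hy0.le]
  -- (y^a)⁻¹ ≤ (2/a)² (log y)⁻²  ⟸  log² y ≤ (2/a)² y^a
  have e : (2 / a) ^ 2 * (Real.log y)⁻¹ ^ 2 = ((2 / a) ^ 2 * y ^ a) * ((y ^ a)⁻¹ * (Real.log y ^ 2)⁻¹) := by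
    field_simp
  rw [e]
  have hl2 : 0 < Real.log y ^ 2 := by positivity
  calc (y ^ a)⁻¹ = Real.log y ^ 2 * ((y ^ a)⁻¹ * (Real.log y ^ 2)⁻¹) := by field_simp
    _ ≤ ((2 / a) ^ 2 * y ^ a) * ((y ^ a)⁻¹ * (Real.log y ^ 2)⁻¹) :=
        mul_le_mul_of_nonneg_right h3 (by positivity)

/-- **The first mollified moment at `Q = 1` for mollifier lengths `q̂^{Δ'}`, `0 < Δ' < 2`: the KMV
first display holds with ZERO extra main term.** From Bettin's twisted first moment
(`Σ^h λ_f(m)L(½,f) = m^{−1/2} + O_ε(m^{1/2}q^{−1+ε})`) and the main-term evaluation of the diagonal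
sum: `L^h(P,1) = q̂^{1/2}S_P(M) + O(q̂^{1/2}‖P‖_∞ M q^{−1+ε})`, `M = q̂^{Δ'} ≤ q^{Δ'/2}`,
`ε = (2−Δ')/4`, and `q^{−(2−Δ')/4} ≤ (8/(2−Δ'))²(log q̂)⁻²`.
[cite: Bettin2017, Thm. 1.1] [cite: KowalskiMichelVanderKam2000, §4 (16), (20), Prop. 4.1 (case k = 0)] -/
theorem firstDisplay_of_bettin (hB : bettin2017_theorem11_primeLevel) {P : ℝ[X]}
    (hS : MollifierMainTermAsymp P) {Δ : ℝ} (hΔ0 : 0 < Δ) (hΔ2 : Δ < 2) :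
    ∃ C : ℝ, ∃ q₀ : ℕ, ∀ (q : ℕ) [NeZero q], q.Prime → q₀ ≤ q →
      ‖LhPQ q P 1 (qhat q ^ Δ) -
          ((riemannZeta 2 * ((Real.sqrt (qhat q) / (Δ * Real.log (qhat q)) : ℝ) : ℂ)) *
            ((KMV2000.linForm Δ P 1 + 0 : ℝ) : ℂ))‖ ≤
        C * Real.sqrt (qhat q) * (Real.log (qhat q))⁻¹ ^ 2 := by
  obtain ⟨B, hB0, hBP⟩ := exists_abs_eval_le_on_unitInterval P
  set a : ℝ := (2 - Δ) / 4 with ha_def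
  have ha : 0 < a := by rw [ha_def]; linarith
  obtain ⟨C_B, N₀, hCB⟩ := hB a ha
  obtain ⟨C_S, M₀, hCS⟩ := hS
  obtain ⟨N₁, hN₁⟩ := exists_log_qhat_ge (Real.log (max M₀ 1) / Δ)
  refine ⟨|C_S| / Δ ^ 2 + B * |C_B| * (2 / a) ^ 2, max (max N₀ N₁) 300, fun q _ hq hq₀ ↦ ?_⟩
  -- sizes
  have hq300 : 300 ≤ q := le_trans (le_max_right _ _) hq₀
  have hqN₀ : N₀ ≤ q := le_trans (le_trans (le_max_left _ _) (le_max_left _ _)) hq₀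
  have hqN₁ : N₁ ≤ q := le_trans (le_trans (le_max_right _ _) (le_max_left _ _)) hq₀
  have hq1 : 1 ≤ q := le_trans (by norm_num) hq300
  have hq40 : 40 ≤ q := le_trans (by norm_num) hq300
  have hqR : (1 : ℝ) < q := by exact_mod_cast lt_of_lt_of_le (by norm_num) hq300
  have hqR0 : (0 : ℝ) < q := by linarith
  have hqhat1 : 1 < qhat q := one_lt_qhat hq40
  have hqhat0 : 0 < qhat q := lt_trans one_pos hqhat1
  set x : ℝ := Real.log (qhat q) with hx_def
  have hx1 : 1 ≤ x := one_le_log_qhat hq300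
  have hx0 : 0 < x := by linarith
  set M : ℝ := qhat q ^ Δ with hM_def
  have hM1 : 1 < M := Real.one_lt_rpow hqhat1 hΔ0
  have hM0 : 0 < M := by linarith
  have hlogM : Real.log M = Δ * x := by rw [hM_def, Real.log_rpow hqhat0]
  -- `M ≥ M₀`
  have hMM₀ : M₀ ≤ M := by
    have h1 : Real.log (max M₀ 1) ≤ Real.log M := by
      rw [hlogM]
      have := hN₁ q hqN₁
      rw [div_le_iff₀ hΔ0] at this
      linarith
    have h2 : max M₀ 1 ≤ M := (Real.log_le_log_iff (by positivity) hM0).1 h1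
    exact le_trans (le_max_left _ _) h2
  -- `M · q^{−1+a} ≤ (2/a)² x⁻²`
  have hMq : M * (q : ℝ) ^ (-1 + a) ≤ (2 / a) ^ 2 * x⁻¹ ^ 2 := by
    have hM_le : M ≤ (q : ℝ) ^ (Δ / 2) := by
      have h1 : M ≤ (Real.sqrt q) ^ Δ := Real.rpow_le_rpow hqhat0.le qhat_le_sqrt hΔ0.le
      rw [Real.sqrt_eq_rpow, ← Real.rpow_mul hqR0.le] at h1
      rw [show Δ / 2 = 1 / 2 * Δ by ring]
      exact h1
    have hprod : M * (q : ℝ) ^ (-1 + a) ≤ (q : ℝ) ^ (-a) := by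
      calc M * (q : ℝ) ^ (-1 + a) ≤ (q : ℝ) ^ (Δ / 2) * (q : ℝ) ^ (-1 + a) := by
            gcongr
        _ = (q : ℝ) ^ (-a) := by
            rw [← Real.rpow_add hqR0]
            congr 1
            rw [ha_def]
            ring
    have hqa : (q : ℝ) ^ (-a) ≤ (2 / a) ^ 2 * (Real.log q)⁻¹ ^ 2 := rpow_neg_le_div_log_sq hqR ha
    have hxq : x ≤ Real.log q := by
      rw [hx_def]
      exact Real.log_le_log hqhat0 (qhat_le_self hq1)
    have hlq : (Real.log q)⁻¹ ^ 2 ≤ x⁻¹ ^ 2 := by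
      gcongr
    calc M * (q : ℝ) ^ (-1 + a) ≤ (q : ℝ) ^ (-a) := hprod
      _ ≤ (2 / a) ^ 2 * (Real.log q)⁻¹ ^ 2 := hqa
      _ ≤ (2 / a) ^ 2 * x⁻¹ ^ 2 := by gcongr
  -- the twisted moments and their errors
  set I := Icc 1 ⌊M⌋₊ with hI_def
  set H : ℕ → ℂ := fun m ↦ GL2Family.harmonicSum q 2
    (fun f ↦ GL2Family.heckeLambda f m * IwaniecSarnak.centralValue f) with hH_def
  set E : ℕ → ℂ := fun m ↦ H m - (((m : ℝ) ^ (-(1 / 2 : ℝ)) : ℝ) : ℂ) with hE_def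
  have hE : ∀ m ∈ I, ‖E m‖ ≤ |C_B| * (m : ℝ) ^ (1 / 2 : ℝ) * (q : ℝ) ^ (-1 + a) := by
    intro m hm
    have hm1 : 1 ≤ m := (Finset.mem_Icc.1 hm).1
    have h := hCB q hq hqN₀ m hm1
    refine h.trans ?_
    exact mul_le_mul_of_nonneg_right (mul_le_mul_of_nonneg_right (le_abs_self _)
      (Real.rpow_nonneg (Nat.cast_nonneg _) _)) (Real.rpow_nonneg hqR0.le _)
  have hxm : ∀ m ∈ I, |mollifierCoeff P M m| ≤ B * (m : ℝ) ^ (-(1 / 2 : ℝ)) :=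
    fun m hm ↦ abs_mollifierCoeff_le hBP hM1 hm
  -- the decomposition `L^h − main = √q̂ · ((S_P(M) − ζ(2)P′(1)/log M) + Σ x_m E_m)`
  have hsqrt : ((qhat q : ℝ) : ℂ) ^ (1 / 2 : ℂ) = ((Real.sqrt (qhat q) : ℝ) : ℂ) := by
    rw [Real.sqrt_eq_rpow, Complex.ofReal_cpow hqhat0.le]
    norm_num
  have hsum : ∑ m ∈ I, (mollifierCoeff P M m : ℂ) * H m =
      ((mollifierMainSum P M : ℝ) : ℂ) + ∑ m ∈ I, (mollifierCoeff P M m : ℂ) * E m := by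
    rw [← sum_mollifierCoeff_mul_rpow, Complex.ofReal_sum, ← Finset.sum_add_distrib]
    refine Finset.sum_congr rfl fun m _ ↦ ?_
    simp only [hE_def]
    push_cast
    ring
  have hdec : LhPQ q P 1 M -
      ((riemannZeta 2 * ((Real.sqrt (qhat q) / (Δ * x) : ℝ) : ℂ)) * ((linForm Δ P 1 + 0 : ℝ) : ℂ)) =
      ((Real.sqrt (qhat q) : ℝ) : ℂ) *
        (((mollifierMainSum P M - π ^ 2 / 6 * (derivative P).eval 1 / Real.log M : ℝ) : ℂ) +
          ∑ m ∈ I, (mollifierCoeff P M m : ℂ) * E m) := by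
    rw [LhPQ_one_eq_twisted, hsqrt, ← hI_def, hsum, riemannZeta_two, linForm_one_right, hlogM]
    have hΔx : ((Δ * x : ℝ) : ℂ) ≠ 0 := by
      exact_mod_cast (mul_pos hΔ0 hx0).ne'
    push_cast
    field_simp
    ring
  rw [hdec, norm_mul, Complex.norm_real, Real.norm_eq_abs, abs_of_nonneg (Real.sqrt_nonneg _)]
  -- the two bounds
  have h1 : ‖((mollifierMainSum P M - π ^ 2 / 6 * (derivative P).eval 1 / Real.log M : ℝ) : ℂ)‖ ≤
      |C_S| / Δ ^ 2 * x⁻¹ ^ 2 := by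
    rw [Complex.norm_real, Real.norm_eq_abs]
    refine (hCS M hMM₀).trans ?_
    rw [hlogM]
    have e : |C_S| / Δ ^ 2 * x⁻¹ ^ 2 = |C_S| / (Δ * x) ^ 2 := by
      field_simp
    rw [e]
    exact div_le_div_of_nonneg_right (le_abs_self _) (by positivity)
  have h2 : ‖∑ m ∈ I, (mollifierCoeff P M m : ℂ) * E m‖ ≤ B * |C_B| * (2 / a) ^ 2 * x⁻¹ ^ 2 := by
    calc ‖∑ m ∈ I, (mollifierCoeff P M m : ℂ) * E m‖
        ≤ ∑ m ∈ I, ‖(mollifierCoeff P M m : ℂ) * E m‖ := norm_sum_le _ _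
      _ ≤ ∑ m ∈ I, B * |C_B| * (q : ℝ) ^ (-1 + a) := by
          refine Finset.sum_le_sum fun m hm ↦ ?_
          have hm0 : (0 : ℝ) < m := by exact_mod_cast (Finset.mem_Icc.1 hm).1
          rw [norm_mul, Complex.norm_real, Real.norm_eq_abs]
          calc |mollifierCoeff P M m| * ‖E m‖
              ≤ (B * (m : ℝ) ^ (-(1 / 2 : ℝ))) *
                  (|C_B| * (m : ℝ) ^ (1 / 2 : ℝ) * (q : ℝ) ^ (-1 + a)) :=
                mul_le_mul (hxm m hm) (hE m hm) (norm_nonneg _) (by positivity)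
            _ = B * |C_B| * ((m : ℝ) ^ (-(1 / 2 : ℝ)) * (m : ℝ) ^ (1 / 2 : ℝ)) *
                  (q : ℝ) ^ (-1 + a) := by ring
            _ = B * |C_B| * (q : ℝ) ^ (-1 + a) := by
                rw [← Real.rpow_add hm0]
                norm_num
      _ = (⌊M⌋₊ : ℝ) * (B * |C_B| * (q : ℝ) ^ (-1 + a)) := by
          rw [Finset.sum_const, hI_def, Nat.card_Icc, nsmul_eq_mul]
          push_cast
          ring
      _ ≤ M * (B * |C_B| * (q : ℝ) ^ (-1 + a)) := by
          gcongr
          exact Nat.floor_le hM0.le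
      _ = B * |C_B| * (M * (q : ℝ) ^ (-1 + a)) := by ring
      _ ≤ B * |C_B| * ((2 / a) ^ 2 * x⁻¹ ^ 2) := by gcongr
      _ = B * |C_B| * (2 / a) ^ 2 * x⁻¹ ^ 2 := by ring
  calc Real.sqrt (qhat q) *
        ‖((mollifierMainSum P M - π ^ 2 / 6 * (derivative P).eval 1 / Real.log M : ℝ) : ℂ) +
          ∑ m ∈ I, (mollifierCoeff P M m : ℂ) * E m‖
      ≤ Real.sqrt (qhat q) * (|C_S| / Δ ^ 2 * x⁻¹ ^ 2 + B * |C_B| * (2 / a) ^ 2 * x⁻¹ ^ 2) := by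
        refine mul_le_mul_of_nonneg_left ((norm_add_le _ _).trans (add_le_add h1 h2))
          (Real.sqrt_nonneg _)
    _ = (|C_S| / Δ ^ 2 + B * |C_B| * (2 / a) ^ 2) * Real.sqrt (qhat q) * x⁻¹ ^ 2 := by ring

/-! ## §5. Uniqueness pins the first correction: `T₁(Δ', P, 1) = 0` for `1 < Δ' < min Δ 2` -/

omit [NeZero q] in
/-- **The first off-diagonal correction vanishes below length `2` (at `Q = 1`).** If the KMV moment
asymptotics hold on a window `(1, Δ]` with extra main terms `T₁, T₂` (no hypothesis `Δ > 1` is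
needed: the window below is non-empty only then), then for every admissible
profile `P` whose diagonal sum has the main-term evaluation `MollifierMainTermAsymp P`, and every
`1 < Δ' < min Δ 2`, `T₁ Δ' P 1 = 0`: on the window `(1, Δ']` the pair `(T₁′, T₂)` with `T₁′ = 0`
at `(P, 1)` and `T₁′ = T₁` elsewhere is ALSO consistent (its first display at `(P, 1)` is
`firstDisplay_of_bettin`, every other display is the hypothesis' own), and MA-consistent first
corrections agree on `(0, 2]` (`T₁_eq_of_momentAsymptotics_of_le_two`: primes with `q̂^{Δ'} ∉ ℕ`
are unbounded). [cite: Bettin2017, Thm. 1.1]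
[cite: KowalskiMichelVanderKam2000, §6 p. 19 (shape of the first display), §2 p. 7 (M ∉ ℤ)] -/
theorem T₁_apply_one_eq_zero (hB : bettin2017_theorem11_primeLevel) {P : ℝ[X]}
    (hP : Admissible P) (hS : MollifierMainTermAsymp P) {Δ : ℝ}
    {T₁ T₂ : ℝ → ℝ[X] → ℝ[X] → ℝ} (hMA : MomentAsymptotics 1 Δ T₁ T₂) {Δ' : ℝ} (h1 : 1 < Δ')
    (h2 : Δ' < min Δ 2) : T₁ Δ' P 1 = 0 := by
  classical
  have hΔ'Δ : Δ' ≤ Δ := (lt_of_lt_of_le h2 (min_le_left _ _)).le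
  have hΔ'2 : Δ' < 2 := lt_of_lt_of_le h2 (min_le_right _ _)
  -- restriction of the hypothesis to the window `(1, Δ']`
  have hMAr : MomentAsymptotics 1 Δ' T₁ T₂ := fun P' Q' hP' hQ' d hd1 hd2 ↦
    hMA P' Q' hP' hQ' d hd1 (hd2.trans hΔ'Δ)
  -- the comparison functional: `0` at `(P, 1)`, `T₁` elsewhere
  obtain ⟨T₁', hT₁'⟩ : ∃ T : ℝ → ℝ[X] → ℝ[X] → ℝ,
      ∀ d P' Q', T d P' Q' = if P' = P ∧ Q' = 1 then 0 else T₁ d P' Q' :=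
    ⟨fun d P' Q' ↦ if P' = P ∧ Q' = 1 then 0 else T₁ d P' Q', fun _ _ _ ↦ rfl⟩
  have hMA' : MomentAsymptotics 1 Δ' T₁' T₂ := by
    intro P' Q' hP' hQ' d hd1 hd2
    by_cases hc : P' = P ∧ Q' = 1
    · obtain ⟨rfl, rfl⟩ := hc
      have hd0 : 0 < d := by linarith
      have hd2' : d < 2 := lt_of_le_of_lt hd2 hΔ'2
      obtain ⟨C₁, q₁, H₁⟩ := firstDisplay_of_bettin hB hS hd0 hd2'
      obtain ⟨C₂, q₂, H₂⟩ := hMAr P' 1 hP' hQ' d hd1 hd2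
      refine ⟨max C₁ C₂, max (max q₁ q₂) 40, fun q _ hq hq₀ hgood ↦ ⟨?_, ?_⟩⟩
      · have h := H₁ q hq (le_trans (le_trans (le_max_left _ _) (le_max_left _ _)) hq₀)
        rw [hT₁', if_pos ⟨rfl, rfl⟩]
        exact h.trans (mul_le_mul_of_nonneg_right
          (mul_le_mul_of_nonneg_right (le_max_left _ _) (Real.sqrt_nonneg _)) (sq_nonneg _))
      · have h := (H₂ q hq (le_trans (le_trans (le_max_right _ _) (le_max_left _ _)) hq₀) hgood).2
        have hq1 : 1 ≤ qhat q := (one_lt_qhat (le_trans (le_max_right _ _) hq₀)).le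
        have hq' : 0 ≤ qhat q := zero_le_one.trans hq1
        have hlog : 0 ≤ (Real.log (qhat q))⁻¹ := inv_nonneg.mpr (Real.log_nonneg hq1)
        exact h.trans (mul_le_mul_of_nonneg_right
          (mul_le_mul_of_nonneg_right (le_max_right _ _) hq') (pow_nonneg hlog 3))
    · obtain ⟨C₂, q₂, H₂⟩ := hMAr P' Q' hP' hQ' d hd1 hd2
      refine ⟨C₂, q₂, fun q _ hq hq₀ hgood ↦ ?_⟩
      rw [hT₁', if_neg hc]
      exact H₂ q hq hq₀ hgood
  have key := T₁_eq_of_momentAsymptotics_of_le_two hMAr hMA' hP isEvenOrOdd_one h1 le_rfl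
    (by linarith) hΔ'2.le
  rw [key, hT₁', if_pos ⟨rfl, rfl⟩]

/-! ## §6. The route stub S1 (corrected binder) from the two displayed hypotheses -/

omit [NeZero q] in
/-- **S1 `stub_firstCorrectionVanishes`, corrected form `Δ' < min Δ 2`** (route `PrimeLevelFamEdge`,
crux `BeyondDiagonalBeatsQuarter`, ls-ref-1 STUBNOTE-birth v0.3: the endpoint `Δ' = 2` is never
used by `K_B_of`): for every window `(1, Δ]` and every MA-consistent `(T₁, T₂)`, the first
correction of the profile `X²` at `Q = 1` vanishes on `(1, min Δ 2)` — GIVEN Bettin's printed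
twisted first moment at prime level and the main-term evaluation of the diagonal sum for `X²`.
[cite: Bettin2017, Thm. 1.1] [cite: KowalskiMichelVanderKam2000, Prop. 4.1 and §6 p. 19] -/
theorem firstCorrectionVanishes_of_bettin (hB : bettin2017_theorem11_primeLevel)
    (hS : MollifierMainTermAsymp (X ^ 2)) :
    ∀ Δ : ℝ, 1 < Δ → ∀ T₁ T₂ : ℝ → ℝ[X] → ℝ[X] → ℝ, MomentAsymptotics 1 Δ T₁ T₂ →
      ∀ Δ' : ℝ, 1 < Δ' → Δ' < min Δ 2 → T₁ Δ' (X ^ 2) 1 = 0 :=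
  fun _ _ _ _ hMA _ h1 h2 ↦ T₁_apply_one_eq_zero hB admissible_X_sq hS hMA h1 h2

omit [NeZero q] in
/-- The same for EVERY admissible profile (all `P` with `P(0) = P′(0) = 0` whose diagonal sum is
evaluated), in the quantifier shape of the crux line. [cite: Bettin2017, Thm. 1.1]
[cite: KowalskiMichelVanderKam2000, Prop. 4.1 and §6 p. 19] -/
theorem firstCorrectionVanishes_of_bettin' (hB : bettin2017_theorem11_primeLevel)
    (hS : ∀ P : ℝ[X], Admissible P → MollifierMainTermAsymp P) :
    ∀ Δ : ℝ, 1 < Δ → ∀ T₁ T₂ : ℝ → ℝ[X] → ℝ[X] → ℝ, MomentAsymptotics 1 Δ T₁ T₂ →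
      ∀ P : ℝ[X], Admissible P → ∀ Δ' : ℝ, 1 < Δ' → Δ' < min Δ 2 → T₁ Δ' P 1 = 0 :=
  fun _ _ _ _ hMA P hP _ h1 h2 ↦ T₁_apply_one_eq_zero hB hP (hS P hP) hMA h1 h2

end KMV2000

end Literature.NumberTheory.LFunctions
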